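import Summits.Parity.BatemanHorn.Theorems.SoloInformedTwinBalancedSplit

/-!
# SoloInformedTwinFarTailCofactors — the balanced far tail of the located twin sum in COFACTOR
# coordinates: a sum of dilated two-point Möbius correlations, with the Chowla corner

Solo unit `solo-Parity-informed` (ideation tier, informed mode), session 48; `paper.md` §20
(Corollary 20.4, Remark 20.12), `SHARPEST-STATEMENT.md` §2 Theorem F / §4L, CLAIMS C126.

`SoloInformedTwinBalancedSplit` (C120) proves, under the two prose inputs (F′), (F) of paper.md §20
typed as hypotheses, `π₂(x) ~ 2C₂x/log²x ⟺ R = o(x)`, where the BALANCED FAR TAIL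
`R = twinBalancedFarSum x y z Y = ∑_{e₁,e₂ ≤ x+2 : min(e₁,e₂) > z, e₁e₂ > Y} 𝟙[e₁e₂ > y] μ(e₁)μ(e₂) log²(e₁e₂) N(e₁,e₂;x)`
is indexed by the LARGE divisor pair `(e₁ ∣ n, e₂ ∣ n+2)` (`N` = C118's pair count: odd `n ≤ x` with
`e₁ ∣ n, e₂ ∣ n+2`, plus `m ≤ x/2` with `e₁ ∣ m, e₂ ∣ m+1`).  The programme's documents READ this sum as
"pair-Chowla with balanced cofactors `m₁ = n/e₁`, `m₂ = (n+2)/e₂`, whose corner `m₁ = m₂ = 1` is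
`∑ μ(n)μ(n+2) log²(n(n+2))`".  This file makes that reading a kernel identity, for all `x y z Y : ℕ`:

* `twinBalancedFarSum_eq_sum_cofactorTerm` —
  `R = ∑_{m₁,m₂ ≤ x+2} twinCofactorTerm x y z Y m₁ m₂`, where `twinCofactorTerm … m₁ m₂` is the sum over
  odd `n ≤ x` in the progression `n ≡ 0 (mod m₁)`, `n ≡ -2 (mod m₂)` of
  `μ(n/m₁) μ((n+2)/m₂) log²((n/m₁)((n+2)/m₂))` restricted to the FINAL SEGMENT
  `n/m₁ > z`, `(n+2)/m₂ > z`, `(n/m₁)((n+2)/m₂) > max(y, Y)` (the weight `twinFarWeight`), plus the even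
  twin over `m ≤ x/2`, `m ≡ 0 (m₁)`, `m ≡ -1 (m₂)` — a DILATED TWO-POINT MÖBIUS CORRELATION per
  cofactor pair (complementary-divisor involutions `e ↦ n/e` on `n.divisors` and `(n+2).divisors`,
  and the swap between pair-indexing and `n`-indexing, `sum_sum_divisors_eq_sum_Icc_sum_filter`);
* `twinCofactorTerm_one_one_eq` — the CORNER `(m₁,m₂) = (1,1)` is
  `∑_{n ≤ x odd, n > z, n(n+2) > max(y,Y)} μ(n)μ(n+2) log²(n(n+2)) + ∑_{m ≤ x/2, m > z, m(m+1) > max(y,Y)} μ(m)μ(m+1) log²(m(m+1))`,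
  the two-point Chowla sums with the weight `log²`;
* support: `twinCofactorTerm … m₁ m₂ = 0` unless `(z+1)m₁ ≤ x`, `(z+1)m₂ ≤ x+2` and
  `(Y+1)m₁m₂ ≤ x(x+2)` (`twinCofactorTerm_eq_zero_of_lt_mul_left/right`, `…_of_lt_mul_mul`), whence the
  identity with the cofactor ranges `m₁ ≤ x/(z+1)`, `m₂ ≤ (x+2)/(z+1)`
  (`twinBalancedFarSum_eq_sum_cofactorTerm_range`); with the prose parameters `z = ⌊x^{1/2-ε₀}⌋`,
  `Y = ⌊x^{1+η}⌋` these are `m₁, m₂ < x^{1/2+ε₀}(1+o(1))`, `m₁m₂ < x^{1-η}(1+2/x)`.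

So, granted (F′) and (F) (prose), Hardy–Littlewood for prime pairs is EXACTLY the statement that this
double sum of dilated two-point Möbius correlations, over `≍ x^{1-η} log x` balanced cofactor pairs,
each of length `≍ x/(m₁m₂) ≥ x^{η}`, with the Chowla sum `∑ μ(n)μ(n+2) log²(n(n+2))` at its corner, is
`o(x)`.  Pure bookkeeping; nothing analytic is proved here and it makes nothing easier.
-/

namespace Summit.Parity.BatemanHorn.Theorems

open Finset ArithmeticFunction
open scoped ArithmeticFunction.Moebius

/-! ### 1. Divisor-pair indexing versus `n`-indexing -/

/-- A double sum over the divisor pairs `(d₁ ∣ n, d₂ ∣ n + a)` as a double sum over the box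
`[1, B]²` with an indicator (`0 < n`, `n + a ≤ B`); the divisors of `0 < N ≤ B` are the
`d ∈ [1, B]` dividing `N` (folklore, as in `SoloInformedTwinPairSum`). -/
theorem sum_divisors_divisors_eq_sum_Icc_ite {n a B : ℕ} (hn : 0 < n) (hB : n + a ≤ B)
    (g : ℕ → ℕ → ℝ) :
    ∑ d₁ ∈ n.divisors, ∑ d₂ ∈ (n + a).divisors, g d₁ d₂
      = ∑ d₁ ∈ Icc 1 B, ∑ d₂ ∈ Icc 1 B, if d₁ ∣ n ∧ d₂ ∣ n + a then g d₁ d₂ else 0 := by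
  have hdiv : ∀ N, 0 < N → N ≤ B → N.divisors = (Icc 1 B).filter (· ∣ N) := by
    intro N hN hNB
    ext d
    simp only [Nat.mem_divisors, mem_filter, mem_Icc]
    constructor
    · rintro ⟨hd, -⟩
      exact ⟨⟨Nat.pos_of_dvd_of_pos hd hN, (Nat.le_of_dvd hN hd).trans hNB⟩, hd⟩
    · rintro ⟨-, hd⟩
      exact ⟨hd, hN.ne'⟩
  rw [hdiv n hn (by omega), hdiv (n + a) (by omega) hB, sum_filter]
  refine sum_congr rfl fun d₁ _ => ?_
  rw [sum_filter]
  by_cases h1 : d₁ ∣ n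
  · simp [h1]
  · simp [h1]

/-- **Swap lemma.**  Summing `g n d₁ d₂` over `n ∈ S` and the divisor pairs `(d₁ ∣ n, d₂ ∣ n + a)` is
summing over the pairs `(d₁, d₂) ∈ [1, B]²` and the `n ∈ S` with `d₁ ∣ n`, `d₂ ∣ n + a`
(all `n ∈ S` positive with `n + a ≤ B`). -/
theorem sum_sum_divisors_eq_sum_Icc_sum_filter (S : Finset ℕ) {a B : ℕ}
    (hS : ∀ n ∈ S, 0 < n ∧ n + a ≤ B) (g : ℕ → ℕ → ℕ → ℝ) :
    ∑ n ∈ S, ∑ d₁ ∈ n.divisors, ∑ d₂ ∈ (n + a).divisors, g n d₁ d₂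
      = ∑ d₁ ∈ Icc 1 B, ∑ d₂ ∈ Icc 1 B, ∑ n ∈ S with (d₁ ∣ n ∧ d₂ ∣ n + a), g n d₁ d₂ := by
  rw [sum_congr rfl fun n hn => sum_divisors_divisors_eq_sum_Icc_ite (hS n hn).1 (hS n hn).2 (g n),
    sum_comm]
  refine sum_congr rfl fun d₁ _ => ?_
  rw [sum_comm]
  refine sum_congr rfl fun d₂ _ => ?_
  rw [sum_filter]

/-- Weight × pair count, pairs indexed over `[1, B]²`, as a sum over `n` and its divisor pairs. -/
theorem sum_sum_mul_card_filter_eq (S : Finset ℕ) {a B : ℕ} (hS : ∀ n ∈ S, 0 < n ∧ n + a ≤ B)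
    (w : ℕ → ℕ → ℝ) :
    ∑ d₁ ∈ Icc 1 B, ∑ d₂ ∈ Icc 1 B, w d₁ d₂ * (#{n ∈ S | d₁ ∣ n ∧ d₂ ∣ n + a} : ℝ)
      = ∑ n ∈ S, ∑ d₁ ∈ n.divisors, ∑ d₂ ∈ (n + a).divisors, w d₁ d₂ := by
  rw [sum_sum_divisors_eq_sum_Icc_sum_filter S hS (fun _ d₁ d₂ => w d₁ d₂)]
  refine sum_congr rfl fun d₁ _ => sum_congr rfl fun d₂ _ => ?_
  rw [sum_const, nsmul_eq_mul, mul_comm]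

/-- **Complementary divisors.**  Re-index both divisor variables by their cofactors
`m₁ = n/d₁`, `m₂ = k/d₂`. -/
theorem sum_divisors_divisors_eq_sum_div (n k : ℕ) (w : ℕ → ℕ → ℝ) :
    ∑ d₁ ∈ n.divisors, ∑ d₂ ∈ k.divisors, w d₁ d₂
      = ∑ m₁ ∈ n.divisors, ∑ m₂ ∈ k.divisors, w (n / m₁) (k / m₂) := by
  symm
  calc ∑ m₁ ∈ n.divisors, ∑ m₂ ∈ k.divisors, w (n / m₁) (k / m₂)
      = ∑ e₁ ∈ n.divisors, ∑ m₂ ∈ k.divisors, w e₁ (k / m₂) :=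
        Nat.sum_div_divisors n (fun e => ∑ m₂ ∈ k.divisors, w e (k / m₂))
    _ = ∑ e₁ ∈ n.divisors, ∑ e₂ ∈ k.divisors, w e₁ e₂ :=
        sum_congr rfl fun e₁ _ => Nat.sum_div_divisors k (fun e => w e₁ e)

/-! ### 2. The objects: the far-tail weight and the cofactor term -/

/-- The weight of a divisor pair `(e₁, e₂)` in the balanced far tail of `T(x; y)`:
`𝟙[min(e₁,e₂) > z] 𝟙[e₁e₂ > Y] 𝟙[e₁e₂ > y] μ(e₁)μ(e₂) log²(e₁e₂)`. -/
noncomputable def twinFarWeight (y z Y e₁ e₂ : ℕ) : ℝ :=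
  if z < min e₁ e₂ ∧ Y < e₁ * e₂ then
    (if y < e₁ * e₂ then (μ e₁ : ℝ) * μ e₂ * Real.log (e₁ * e₂ : ℕ) ^ 2 else 0) else 0

/-- **The cofactor term** of the pair `(m₁, m₂)`: the dilated two-point Möbius correlation
`∑_{n ≤ x odd, m₁ ∣ n, m₂ ∣ n+2} w(n/m₁, (n+2)/m₂) + ∑_{m ≤ x/2, m₁ ∣ m, m₂ ∣ m+1} w(m/m₁, (m+1)/m₂)`,
`w = twinFarWeight y z Y` (so the `n`-sum is restricted to the final segment `n/m₁, (n+2)/m₂ > z`,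
`(n/m₁)((n+2)/m₂) > max(y, Y)` and weighted by `μ(n/m₁)μ((n+2)/m₂) log²((n/m₁)((n+2)/m₂))`). -/
noncomputable def twinCofactorTerm (x y z Y m₁ m₂ : ℕ) : ℝ :=
  ∑ n ∈ ((Icc 1 x).filter Odd) with (m₁ ∣ n ∧ m₂ ∣ n + 2),
      twinFarWeight y z Y (n / m₁) ((n + 2) / m₂)
    + ∑ m ∈ (Icc 1 (x / 2)) with (m₁ ∣ m ∧ m₂ ∣ m + 1),
      twinFarWeight y z Y (m / m₁) ((m + 1) / m₂)

/-- The balanced far tail as weight × pair count. -/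
theorem twinBalancedFarSum_eq_sum_weight_mul_count (x y z Y : ℕ) :
    twinBalancedFarSum x y z Y
      = ∑ e₁ ∈ Icc 1 (x + 2), ∑ e₂ ∈ Icc 1 (x + 2),
          twinFarWeight y z Y e₁ e₂ * twinPairCount x e₁ e₂ := by
  unfold twinBalancedFarSum twinPairTerm twinFarWeight
  refine sum_congr rfl fun e₁ _ => sum_congr rfl fun e₂ _ => ?_
  split_ifs <;> simp

/-! ### 3. The far tail in cofactor coordinates -/

/-- **The balanced far tail in cofactor coordinates.**  For all `x y z Y`:
`twinBalancedFarSum x y z Y = ∑_{m₁, m₂ ≤ x+2} twinCofactorTerm x y z Y m₁ m₂`. -/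
theorem twinBalancedFarSum_eq_sum_cofactorTerm (x y z Y : ℕ) :
    twinBalancedFarSum x y z Y
      = ∑ m₁ ∈ Icc 1 (x + 2), ∑ m₂ ∈ Icc 1 (x + 2), twinCofactorTerm x y z Y m₁ m₂ := by
  have hSo : ∀ n ∈ (Icc 1 x).filter Odd, 0 < n ∧ n + 2 ≤ x + 2 := fun n hn => by
    have h := mem_Icc.mp (mem_filter.mp hn).1
    omega
  have hSe : ∀ m ∈ Icc 1 (x / 2), 0 < m ∧ m + 1 ≤ x + 2 := fun m hm => by
    have h := mem_Icc.mp hm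
    have : x / 2 ≤ x := Nat.div_le_self x 2
    omega
  rw [twinBalancedFarSum_eq_sum_weight_mul_count]
  simp only [twinPairCount, mul_add, sum_add_distrib, twinCofactorTerm]
  congr 1
  · rw [sum_sum_mul_card_filter_eq _ hSo,
      ← sum_sum_divisors_eq_sum_Icc_sum_filter _ hSo
        (fun n m₁ m₂ => twinFarWeight y z Y (n / m₁) ((n + 2) / m₂))]
    exact sum_congr rfl fun n _ => sum_divisors_divisors_eq_sum_div n (n + 2) (twinFarWeight y z Y)
  · rw [sum_sum_mul_card_filter_eq _ hSe,
      ← sum_sum_divisors_eq_sum_Icc_sum_filter _ hSe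
        (fun m m₁ m₂ => twinFarWeight y z Y (m / m₁) ((m + 1) / m₂))]
    exact sum_congr rfl fun m _ => sum_divisors_divisors_eq_sum_div m (m + 1) (twinFarWeight y z Y)

/-! ### 4. The Chowla corner `(m₁, m₂) = (1, 1)` -/

/-- The corner term is the undilated one: `e₁ = n`, `e₂ = n + 2` (resp. `m`, `m + 1`). -/
theorem twinCofactorTerm_one_one (x y z Y : ℕ) :
    twinCofactorTerm x y z Y 1 1
      = ∑ n ∈ (Icc 1 x).filter Odd, twinFarWeight y z Y n (n + 2)
        + ∑ m ∈ Icc 1 (x / 2), twinFarWeight y z Y m (m + 1) := by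
  have h1 : ((Icc 1 x).filter Odd).filter (fun n => 1 ∣ n ∧ 1 ∣ n + 2) = (Icc 1 x).filter Odd :=
    filter_true_of_mem fun n _ => ⟨one_dvd n, one_dvd (n + 2)⟩
  have h2 : (Icc 1 (x / 2)).filter (fun m => 1 ∣ m ∧ 1 ∣ m + 1) = Icc 1 (x / 2) :=
    filter_true_of_mem fun m _ => ⟨one_dvd m, one_dvd (m + 1)⟩
  unfold twinCofactorTerm
  rw [h1, h2]
  simp only [Nat.div_one]

/-- The weight at a consecutive pair `(n, n + a)`: `𝟙[n > z] 𝟙[n(n+a) > max(y, Y)] μ(n)μ(n+a) log²(n(n+a))`. -/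
theorem twinFarWeight_self_add (y z Y n a : ℕ) :
    twinFarWeight y z Y n (n + a)
      = if z < n ∧ max y Y < n * (n + a) then
          (μ n : ℝ) * μ (n + a) * Real.log (n * (n + a) : ℕ) ^ 2 else 0 := by
  unfold twinFarWeight
  rw [min_eq_left (Nat.le_add_right n a)]
  by_cases h1 : z < n <;> by_cases h2 : Y < n * (n + a) <;> by_cases h3 : y < n * (n + a) <;>
    simp [h1, h2, h3]

/-- **The Chowla corner.**  The cofactor pair `(1, 1)` contributes the two-point Chowla sums with
weight `log²`: `∑_{n ≤ x odd, n > z, n(n+2) > max(y,Y)} μ(n)μ(n+2) log²(n(n+2))`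
`+ ∑_{m ≤ x/2, m > z, m(m+1) > max(y,Y)} μ(m)μ(m+1) log²(m(m+1))`. -/
theorem twinCofactorTerm_one_one_eq (x y z Y : ℕ) :
    twinCofactorTerm x y z Y 1 1
      = ∑ n ∈ ((Icc 1 x).filter Odd) with (z < n ∧ max y Y < n * (n + 2)),
            (μ n : ℝ) * μ (n + 2) * Real.log (n * (n + 2) : ℕ) ^ 2
        + ∑ m ∈ (Icc 1 (x / 2)) with (z < m ∧ max y Y < m * (m + 1)),
            (μ m : ℝ) * μ (m + 1) * Real.log (m * (m + 1) : ℕ) ^ 2 := by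
  rw [twinCofactorTerm_one_one, sum_filter (fun n => z < n ∧ max y Y < n * (n + 2)),
    sum_filter (fun m => z < m ∧ max y Y < m * (m + 1))]
  simp only [twinFarWeight_self_add]

/-! ### 5. Support of the cofactor pairs -/

/-- The weight vanishes unless `min(e₁, e₂) > z`. -/
theorem twinFarWeight_eq_zero_of_min_le {y z Y e₁ e₂ : ℕ} (h : min e₁ e₂ ≤ z) :
    twinFarWeight y z Y e₁ e₂ = 0 := by
  unfold twinFarWeight
  rw [if_neg fun hc => absurd hc.1 (not_lt.mpr h)]

/-- The weight vanishes unless `e₁e₂ > Y`. -/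
theorem twinFarWeight_eq_zero_of_mul_le {y z Y e₁ e₂ : ℕ} (h : e₁ * e₂ ≤ Y) :
    twinFarWeight y z Y e₁ e₂ = 0 := by
  unfold twinFarWeight
  rw [if_neg fun hc => absurd hc.2 (not_lt.mpr h)]

/-- If `m₁ ∣ n`, `n ≤ x < (z+1)m₁`, then `n/m₁ ≤ z`: the weight vanishes. -/
theorem twinFarWeight_div_left_eq_zero {x y z Y m₁ n : ℕ} (h : x < (z + 1) * m₁) (hn : 1 ≤ n)
    (hnx : n ≤ x) (hd : m₁ ∣ n) (e₂ : ℕ) : twinFarWeight y z Y (n / m₁) e₂ = 0 := by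
  apply twinFarWeight_eq_zero_of_min_le
  refine (min_le_left _ _).trans ?_
  by_contra hc
  have hm : 0 < m₁ := Nat.pos_of_dvd_of_pos hd (by omega)
  have h1 : (z + 1) * m₁ ≤ n := (Nat.le_div_iff_mul_le hm).mp (Nat.succ_le_of_lt (not_le.mp hc))
  exact absurd (h1.trans hnx) (not_le.mpr h)

/-- If `m₂ ∣ k`, `k ≤ B < (z+1)m₂`, then `k/m₂ ≤ z`: the weight vanishes. -/
theorem twinFarWeight_div_right_eq_zero {B y z Y m₂ k : ℕ} (h : B < (z + 1) * m₂) (hk : 1 ≤ k)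
    (hkB : k ≤ B) (hd : m₂ ∣ k) (e₁ : ℕ) : twinFarWeight y z Y e₁ (k / m₂) = 0 := by
  apply twinFarWeight_eq_zero_of_min_le
  refine (min_le_right _ _).trans ?_
  by_contra hc
  have hm : 0 < m₂ := Nat.pos_of_dvd_of_pos hd (by omega)
  have h1 : (z + 1) * m₂ ≤ k := (Nat.le_div_iff_mul_le hm).mp (Nat.succ_le_of_lt (not_le.mp hc))
  exact absurd (h1.trans hkB) (not_le.mpr h)

/-- If `m₁ ∣ n`, `m₂ ∣ k`, `nk ≤ P < (Y+1)m₁m₂`, then `(n/m₁)(k/m₂) ≤ Y`: the weight vanishes. -/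
theorem twinFarWeight_div_div_eq_zero {P y z Y m₁ m₂ n k : ℕ} (h : P < (Y + 1) * (m₁ * m₂))
    (hnk : n * k ≤ P) (hd₁ : m₁ ∣ n) (hd₂ : m₂ ∣ k) :
    twinFarWeight y z Y (n / m₁) (k / m₂) = 0 := by
  apply twinFarWeight_eq_zero_of_mul_le
  by_contra hc
  have h1 : (Y + 1) * (m₁ * m₂) ≤ n / m₁ * (k / m₂) * (m₁ * m₂) :=
    Nat.mul_le_mul_right _ (Nat.succ_le_of_lt (not_le.mp hc))
  have h2 : n / m₁ * (k / m₂) * (m₁ * m₂) = n * k := by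
    rw [show n / m₁ * (k / m₂) * (m₁ * m₂) = (n / m₁ * m₁) * (k / m₂ * m₂) by ring,
      Nat.div_mul_cancel hd₁, Nat.div_mul_cancel hd₂]
  rw [h2] at h1
  exact absurd (h1.trans hnk) (not_le.mpr h)

/-- **Support in `m₁`:** cofactor pairs with `(z+1)·m₁ > x` contribute nothing
(`n/m₁ > z` forces `(z+1)m₁ ≤ n ≤ x`). -/
theorem twinCofactorTerm_eq_zero_of_lt_mul_left {x y z Y m₁ : ℕ} (h : x < (z + 1) * m₁) (m₂ : ℕ) :
    twinCofactorTerm x y z Y m₁ m₂ = 0 := by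
  have h1 : ∀ n ∈ ((Icc 1 x).filter Odd).filter (fun n => m₁ ∣ n ∧ m₂ ∣ n + 2),
      twinFarWeight y z Y (n / m₁) ((n + 2) / m₂) = 0 := by
    intro n hn
    simp only [mem_filter, mem_Icc] at hn
    obtain ⟨⟨⟨hn1, hnx⟩, -⟩, hd, -⟩ := hn
    exact twinFarWeight_div_left_eq_zero h hn1 hnx hd _
  have h2 : ∀ m ∈ (Icc 1 (x / 2)).filter (fun m => m₁ ∣ m ∧ m₂ ∣ m + 1),
      twinFarWeight y z Y (m / m₁) ((m + 1) / m₂) = 0 := by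
    intro m hm
    simp only [mem_filter, mem_Icc] at hm
    obtain ⟨⟨hm1, hmx⟩, hd, -⟩ := hm
    exact twinFarWeight_div_left_eq_zero h hm1 (hmx.trans (Nat.div_le_self x 2)) hd _
  unfold twinCofactorTerm
  rw [sum_eq_zero h1, sum_eq_zero h2, add_zero]

/-- **Support in `m₂`:** cofactor pairs with `(z+1)·m₂ > x + 2` contribute nothing
(`(n+2)/m₂ > z` forces `(z+1)m₂ ≤ n + 2 ≤ x + 2`). -/
theorem twinCofactorTerm_eq_zero_of_lt_mul_right {x y z Y m₂ : ℕ} (h : x + 2 < (z + 1) * m₂)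
    (m₁ : ℕ) : twinCofactorTerm x y z Y m₁ m₂ = 0 := by
  have h1 : ∀ n ∈ ((Icc 1 x).filter Odd).filter (fun n => m₁ ∣ n ∧ m₂ ∣ n + 2),
      twinFarWeight y z Y (n / m₁) ((n + 2) / m₂) = 0 := by
    intro n hn
    simp only [mem_filter, mem_Icc] at hn
    obtain ⟨⟨⟨-, hnx⟩, -⟩, -, hd⟩ := hn
    exact twinFarWeight_div_right_eq_zero h (Nat.le_add_left 1 (n + 1))
      (Nat.add_le_add_right hnx 2) hd _
  have h2 : ∀ m ∈ (Icc 1 (x / 2)).filter (fun m => m₁ ∣ m ∧ m₂ ∣ m + 1),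
      twinFarWeight y z Y (m / m₁) ((m + 1) / m₂) = 0 := by
    intro m hm
    simp only [mem_filter, mem_Icc] at hm
    obtain ⟨⟨-, hmx⟩, -, hd⟩ := hm
    have hmx' : m + 1 ≤ x + 2 := by have := Nat.div_le_self x 2; omega
    exact twinFarWeight_div_right_eq_zero h (Nat.le_add_left 1 m) hmx' hd _
  unfold twinCofactorTerm
  rw [sum_eq_zero h1, sum_eq_zero h2, add_zero]

/-- **Support in the product:** cofactor pairs with `(Y+1)·m₁m₂ > x(x+2)` contribute nothing
(`(n/m₁)((n+2)/m₂) > Y` forces `(Y+1)m₁m₂ ≤ n(n+2) ≤ x(x+2)`). -/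
theorem twinCofactorTerm_eq_zero_of_lt_mul_mul {x y z Y m₁ m₂ : ℕ}
    (h : x * (x + 2) < (Y + 1) * (m₁ * m₂)) : twinCofactorTerm x y z Y m₁ m₂ = 0 := by
  have h1 : ∀ n ∈ ((Icc 1 x).filter Odd).filter (fun n => m₁ ∣ n ∧ m₂ ∣ n + 2),
      twinFarWeight y z Y (n / m₁) ((n + 2) / m₂) = 0 := by
    intro n hn
    simp only [mem_filter, mem_Icc] at hn
    obtain ⟨⟨⟨-, hnx⟩, -⟩, hd₁, hd₂⟩ := hn
    exact twinFarWeight_div_div_eq_zero h (Nat.mul_le_mul hnx (Nat.add_le_add_right hnx 2)) hd₁ hd₂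
  have h2 : ∀ m ∈ (Icc 1 (x / 2)).filter (fun m => m₁ ∣ m ∧ m₂ ∣ m + 1),
      twinFarWeight y z Y (m / m₁) ((m + 1) / m₂) = 0 := by
    intro m hm
    simp only [mem_filter, mem_Icc] at hm
    obtain ⟨⟨-, hmx⟩, hd₁, hd₂⟩ := hm
    have hmx1 : m ≤ x := hmx.trans (Nat.div_le_self x 2)
    have hmx2 : m + 1 ≤ x + 2 := by omega
    exact twinFarWeight_div_div_eq_zero h (Nat.mul_le_mul hmx1 hmx2) hd₁ hd₂
  unfold twinCofactorTerm
  rw [sum_eq_zero h1, sum_eq_zero h2, add_zero]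

/-- **The far tail over the balanced cofactor box.**  For all `x y z Y`:
`twinBalancedFarSum x y z Y = ∑_{m₁ ≤ x/(z+1)} ∑_{m₂ ≤ (x+2)/(z+1)} twinCofactorTerm x y z Y m₁ m₂`
(and inside the box only the pairs with `(Y+1)m₁m₂ ≤ x(x+2)` contribute,
`twinCofactorTerm_eq_zero_of_lt_mul_mul`). -/
theorem twinBalancedFarSum_eq_sum_cofactorTerm_range (x y z Y : ℕ) :
    twinBalancedFarSum x y z Y
      = ∑ m₁ ∈ Icc 1 (x / (z + 1)), ∑ m₂ ∈ Icc 1 ((x + 2) / (z + 1)),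
          twinCofactorTerm x y z Y m₁ m₂ := by
  rw [twinBalancedFarSum_eq_sum_cofactorTerm]
  symm
  have hz : 0 < z + 1 := Nat.succ_pos z
  have h1 : Icc 1 (x / (z + 1)) ⊆ Icc 1 (x + 2) := Icc_subset_Icc_right
    ((Nat.div_le_self x (z + 1)).trans (Nat.le_add_right x 2))
  have h2 : Icc 1 ((x + 2) / (z + 1)) ⊆ Icc 1 (x + 2) := Icc_subset_Icc_right
    (Nat.div_le_self (x + 2) (z + 1))
  rw [sum_subset h1 fun m₁ hm₁ hm₁' => ?_]
  · refine sum_congr rfl fun m₁ _ => sum_subset h2 fun m₂ hm₂ hm₂' => ?_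
    have hlt : (x + 2) / (z + 1) < m₂ := by
      rw [mem_Icc, not_and_or, not_le, not_le] at hm₂'
      exact hm₂'.resolve_left (not_lt.mpr (mem_Icc.mp hm₂).1)
    exact twinCofactorTerm_eq_zero_of_lt_mul_right
      (by rw [mul_comm]; exact (Nat.div_lt_iff_lt_mul hz).mp hlt) m₁
  · have hlt : x / (z + 1) < m₁ := by
      rw [mem_Icc, not_and_or, not_le, not_le] at hm₁'
      exact hm₁'.resolve_left (not_lt.mpr (mem_Icc.mp hm₁).1)
    exact sum_eq_zero fun m₂ _ => twinCofactorTerm_eq_zero_of_lt_mul_left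
      (by rw [mul_comm]; exact (Nat.div_lt_iff_lt_mul hz).mp hlt) m₂

end Summit.Parity.BatemanHorn.Theorems
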